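import Literature.NumberTheory.EllipticCurves.PadicWeierstrassZetaProofs
import HarnessLib

/-!
# The Mazur–Tate constant at `2` as a CONTRACTION FIXED POINT: `c = 2·α(c) + d` in a `2`-adically complete ring
# (step S5′ of the discharge plan for the PRINT stub `stub_sigmaSqTwo`, replacing Blakestad–Grant's Thm. 2 / Lemma 4 at `p = 2`)

Cell `bsd-f1-sign2`, WIDTH-5 attach seat `bsd-line-att-p3` g8 (`--supports stmt-BirchSwinnertonDyer-23008`; plan
`Cruxes/BSDOfMainConjectureRankOneAtTwo/SIGMASQ-AT-TWO-att-p3.md`, S5′/§7). THEOREMS ONLY; route-independent. BSD is not proved by any of this.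

WHY. The squared functional equation along the Vélu `2`-isogeny (`…SigmaSqTwoVeluFE.lean`, `velu_two_X_sq_mul_sq_subst_eq`) holds for the
odd normalised sigma solutions with constants `c` (of `E`) and `c″` (of the Frobenius model `E″ = vc • (E/⟨Q⟩)`, `vc = [2; r, ½, −r/2]`) EXACTLY
when `−r + 4c″ − 2c − e = 0`. In the universal setting (`E` = the `a₁`-chart over `R̂₂`, `E″ = E^α` for the Frobenius-type specialisation
`α : R̂₂ → R̂₂`) Dwork's lemma needs `c″ = α(c)`; so the constant is pinned by `4α(c) − 2c = r + e`, i.e. — with `ρ := (r + e)/2 ∈ R̂₂`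
(recon: `v₂(r + e) ≥ 3`) — by the fixed-point equation **`c = 2α(c) − ρ`**, whose right-hand side is a `2`-ADIC CONTRACTION. Hence `c` exists and
is unique in ANY `2`-adically complete ring, for ANY ring endomorphism `α` — no `p = 2` analogue of Blakestad–Grant's Thm. 2 (exactness of
`(x − β)ω`, odd levels `2B + 3`) is needed to pin the constant.

* `sub_iterate_mem_span_two_pow` — the iterates `cₙ = (c ↦ 2α(c) + d)ⁿ(0)` satisfy `cₙ₊₁ − cₙ ∈ (2ⁿ)`;
* `exists_eq_two_mul_map_add` / `eq_two_mul_map_add_unique` / `existsUnique_eq_two_mul_map_add` — **`∃! c, c = 2α(c) + d`**;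
* `exists_four_mul_map_sub_two_mul_eq` — the form used by the functional equation: `∃ c, 4α(c) − 2c = 2ρ`.

## Sources
Banach/Hensel contraction in an adically complete ring [folklore]; the role of the constant: B. Mazur, J. Tate, *The `p`-adic sigma function*,
Duke Math. J. 62 (1991) §3; C. Blakestad, D. Grant, J. Number Theory 249 (2023) Thm. 2 (the constant `β = −c`). [cite: BlakestadGrant2023, Thm. 2]
-/

noncomputable section

set_option linter.dupNamespace false
set_option autoImplicit false

open Literature.NumberTheory.EllipticCurves

namespace Summit.BirchSwinnertonDyer.BirchSwinnertonDyer.Theorems.AlignedTransportAtTwoSigmaSqTwo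

section FixedPoint

variable {A : Type*} [CommRing A] (α : A →+* A) (d : A)

/-- A ring endomorphism maps `(2ⁿ)` into itself. [folklore] -/
theorem map_mem_span_two_pow {x : A} {n : ℕ} (hx : x ∈ Ideal.span {(2 : A) ^ n}) : α x ∈ Ideal.span {(2 : A) ^ n} := by
  obtain ⟨g, hg⟩ := Ideal.mem_span_singleton'.mp hx
  rw [← hg, map_mul, map_pow, map_ofNat]
  exact Ideal.mem_span_singleton'.mpr ⟨α g, rfl⟩

/-- The iterates `cₙ = (c ↦ 2α(c) + d)ⁿ(0)` of the contraction satisfy `cₙ₊₁ − cₙ ∈ (2ⁿ)`. [folklore] -/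
theorem sub_iterate_mem_span_two_pow (n : ℕ) :
    (fun c => 2 * α c + d)^[n + 1] 0 - (fun c => 2 * α c + d)^[n] 0 ∈ Ideal.span {(2 : A) ^ n} := by
  induction n with
  | zero => rw [pow_zero, Ideal.span_singleton_one]; exact Submodule.mem_top
  | succ n ih =>
    have e : (fun c => 2 * α c + d)^[n + 1 + 1] 0 - (fun c => 2 * α c + d)^[n + 1] 0 =
        2 * α ((fun c => 2 * α c + d)^[n + 1] 0 - (fun c => 2 * α c + d)^[n] 0) := by
      simp only [Function.iterate_succ_apply', map_sub, map_add, map_mul, map_ofNat]; ring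
    rw [e]
    obtain ⟨g, hg⟩ := Ideal.mem_span_singleton'.mp (map_mem_span_two_pow α ih)
    rw [← hg, pow_succ]
    exact Ideal.mem_span_singleton'.mpr ⟨g, by ring⟩

/-- `cₘ − cₙ ∈ (2ⁿ)` for `n ≤ m`. [folklore] -/
theorem sub_iterate_mem_span_two_pow_of_le {n m : ℕ} (h : n ≤ m) :
    (fun c => 2 * α c + d)^[m] 0 - (fun c => 2 * α c + d)^[n] 0 ∈ Ideal.span {(2 : A) ^ n} := by
  induction m, h using Nat.le_induction with
  | base => rw [sub_self]; exact Ideal.zero_mem _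
  | succ m hnm ih =>
    have hle : Ideal.span {(2 : A) ^ m} ≤ Ideal.span {(2 : A) ^ n} := by
      rw [Ideal.span_singleton_le_span_singleton]; exact pow_dvd_pow _ hnm
    have := Ideal.add_mem _ (hle (sub_iterate_mem_span_two_pow α d m)) ih
    rwa [sub_add_sub_cancel] at this

variable [IsAdicComplete (Ideal.span {(2 : A)}) A]

/-- **Existence of the fixed point** `c = 2α(c) + d` in a `2`-adically complete ring (`c = Σ 2ⁱ·αⁱ-twisted terms = lim cₙ`). [folklore] -/
theorem exists_eq_two_mul_map_add : ∃ c : A, c = 2 * α c + d := by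
  set f : ℕ → A := fun n => (fun c => 2 * α c + d)^[n] 0 with hf
  obtain ⟨L, hL⟩ : ∃ L : A, ∀ n, f n - L ∈ Ideal.span {(2 : A) ^ n} := by
    obtain ⟨L, hL⟩ := IsPrecomplete.prec' (I := Ideal.span {(2 : A)}) (M := A) f
      (fun {m n} hmn => by
        rw [Ideal.span_singleton_pow, smodEq_smul_top_iff_sub_mem]
        have h := (Ideal.span {(2 : A) ^ m}).neg_mem (sub_iterate_mem_span_two_pow_of_le α d hmn)
        rwa [neg_sub] at h)
    refine ⟨L, fun n => ?_⟩
    have h := hL n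
    rwa [Ideal.span_singleton_pow, smodEq_smul_top_iff_sub_mem] at h
  refine ⟨L, ?_⟩
  rw [← sub_eq_zero]
  refine IsHausdorff.haus' (I := Ideal.span {(2 : A)}) _ fun n => ?_
  rw [Ideal.span_singleton_pow, smodEq_smul_top_iff_sub_mem, sub_zero]
  have hstep : f (n + 1) = 2 * α (f n) + d := by
    rw [hf]; exact Function.iterate_succ_apply' (f := fun c => 2 * α c + d) n 0
  have e : L - (2 * α L + d) = (L - f (n + 1)) + 2 * α (f n - L) := by rw [hstep, map_sub]; ring
  rw [e]
  refine Ideal.add_mem _ ?_ ?_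
  · have h := (Ideal.span {(2 : A) ^ (n + 1)}).neg_mem (hL (n + 1))
    rw [neg_sub] at h
    have hle : Ideal.span {(2 : A) ^ (n + 1)} ≤ Ideal.span {(2 : A) ^ n} := by
      rw [Ideal.span_singleton_le_span_singleton]; exact pow_dvd_pow _ (Nat.le_succ n)
    exact hle h
  · exact Ideal.mul_mem_left _ _ (map_mem_span_two_pow α (hL n))

omit [IsAdicComplete (Ideal.span {(2 : A)}) A] in
/-- **Uniqueness of the fixed point** in a `2`-adically separated ring. [folklore] -/
theorem eq_two_mul_map_add_unique [IsHausdorff (Ideal.span {(2 : A)}) A] {c c' : A} (hc : c = 2 * α c + d)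
    (hc' : c' = 2 * α c' + d) : c = c' := by
  have hrel : c - c' = 2 * α (c - c') := by rw [map_sub]; linear_combination hc - hc'
  have hmem : ∀ n : ℕ, c - c' ∈ Ideal.span {(2 : A) ^ n} := by
    intro n
    induction n with
    | zero => rw [pow_zero, Ideal.span_singleton_one]; exact Submodule.mem_top
    | succ n ih =>
      obtain ⟨g, hg⟩ := Ideal.mem_span_singleton'.mp (map_mem_span_two_pow α ih)
      rw [hrel, ← hg, pow_succ]
      exact Ideal.mem_span_singleton'.mpr ⟨g, by ring⟩
  rw [← sub_eq_zero]
  refine IsHausdorff.haus' (I := Ideal.span {(2 : A)}) _ fun n => ?_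
  rw [Ideal.span_singleton_pow, smodEq_smul_top_iff_sub_mem, sub_zero]
  exact hmem n

/-- **`∃! c, c = 2α(c) + d`** in a `2`-adically complete ring, for any ring endomorphism `α` and any `d`. [folklore] -/
theorem existsUnique_eq_two_mul_map_add : ∃! c : A, c = 2 * α c + d := by
  obtain ⟨c, hc⟩ := exists_eq_two_mul_map_add α d
  exact ⟨c, hc, fun c' hc' => eq_two_mul_map_add_unique α d hc' hc⟩

/-- **The constants relation of the squared functional equation is solvable**: for every `ρ` there is `c` with `4α(c) − 2c = 2ρ`
(take the fixed point of `c ↦ 2α(c) − ρ`); with `2ρ = r + e` this is `−r + 4α(c) − 2c − e = 0`, hypothesis `hκ` of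
`velu_two_X_sq_mul_sq_subst_eq` with `c″ = α(c)`. [cite: BlakestadGrant2023, Thm. 2] -/
theorem exists_four_mul_map_sub_two_mul_eq (ρ : A) : ∃ c : A, 4 * α c - 2 * c = 2 * ρ := by
  obtain ⟨c, hc⟩ := exists_eq_two_mul_map_add α (-ρ)
  exact ⟨c, by linear_combination (-2 : A) * hc⟩

end FixedPoint

/-! ## The affine contraction `c ↦ 2m·α(c) + d` (any multiplier `m`): the form needed when the Frobenius model has `u = 2μ`, `μ` a unit
(`hκ : −r + 4μ²α(c) − 2c − e = 0` ⟺ `c = 2μ²·α(c) − (r + e)/2`; plan §8 (S3.3)) -/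

section FixedPointMul

variable {A : Type*} [CommRing A] (α : A →+* A) (κ d : A)

/-- The iterates of `c ↦ 2κ·α(c) + d` satisfy `cₙ₊₁ − cₙ ∈ (2ⁿ)`. [folklore] -/
theorem sub_iterate_mul_mem_span_two_pow (n : ℕ) :
    (fun c => 2 * κ * α c + d)^[n + 1] 0 - (fun c => 2 * κ * α c + d)^[n] 0 ∈ Ideal.span {(2 : A) ^ n} := by
  induction n with
  | zero => rw [pow_zero, Ideal.span_singleton_one]; exact Submodule.mem_top
  | succ n ih =>
    have e : (fun c => 2 * κ * α c + d)^[n + 1 + 1] 0 - (fun c => 2 * κ * α c + d)^[n + 1] 0 =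
        2 * κ * α ((fun c => 2 * κ * α c + d)^[n + 1] 0 - (fun c => 2 * κ * α c + d)^[n] 0) := by
      simp only [Function.iterate_succ_apply', map_sub, map_add, map_mul, map_ofNat]; ring
    rw [e]
    obtain ⟨g, hg⟩ := Ideal.mem_span_singleton'.mp (map_mem_span_two_pow α ih)
    rw [← hg, pow_succ]
    exact Ideal.mem_span_singleton'.mpr ⟨κ * g, by ring⟩

/-- `cₘ − cₙ ∈ (2ⁿ)` for `n ≤ m`. [folklore] -/
theorem sub_iterate_mul_mem_span_two_pow_of_le {n k : ℕ} (h : n ≤ k) :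
    (fun c => 2 * κ * α c + d)^[k] 0 - (fun c => 2 * κ * α c + d)^[n] 0 ∈ Ideal.span {(2 : A) ^ n} := by
  induction k, h using Nat.le_induction with
  | base => rw [sub_self]; exact Ideal.zero_mem _
  | succ k hnk ih =>
    have hle : Ideal.span {(2 : A) ^ k} ≤ Ideal.span {(2 : A) ^ n} := by
      rw [Ideal.span_singleton_le_span_singleton]; exact pow_dvd_pow _ hnk
    have := Ideal.add_mem _ (hle (sub_iterate_mul_mem_span_two_pow α κ d k)) ih
    rwa [sub_add_sub_cancel] at this

variable [IsAdicComplete (Ideal.span {(2 : A)}) A]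

/-- **Existence of the fixed point `c = 2κ·α(c) + d`** in a `2`-adically complete ring, any `κ`. [folklore] -/
theorem exists_eq_two_mul_mul_map_add : ∃ c : A, c = 2 * κ * α c + d := by
  set f : ℕ → A := fun n => (fun c => 2 * κ * α c + d)^[n] 0 with hf
  obtain ⟨L, hL⟩ : ∃ L : A, ∀ n, f n - L ∈ Ideal.span {(2 : A) ^ n} := by
    obtain ⟨L, hL⟩ := IsPrecomplete.prec' (I := Ideal.span {(2 : A)}) (M := A) f
      (fun {m n} hmn => by
        rw [Ideal.span_singleton_pow, smodEq_smul_top_iff_sub_mem]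
        have h := (Ideal.span {(2 : A) ^ m}).neg_mem (sub_iterate_mul_mem_span_two_pow_of_le α κ d hmn)
        rwa [neg_sub] at h)
    refine ⟨L, fun n => ?_⟩
    have h := hL n
    rwa [Ideal.span_singleton_pow, smodEq_smul_top_iff_sub_mem] at h
  refine ⟨L, ?_⟩
  rw [← sub_eq_zero]
  refine IsHausdorff.haus' (I := Ideal.span {(2 : A)}) _ fun n => ?_
  rw [Ideal.span_singleton_pow, smodEq_smul_top_iff_sub_mem, sub_zero]
  have hstep : f (n + 1) = 2 * κ * α (f n) + d := by
    rw [hf]; exact Function.iterate_succ_apply' (f := fun c => 2 * κ * α c + d) n 0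
  have e : L - (2 * κ * α L + d) = (L - f (n + 1)) + 2 * κ * α (f n - L) := by rw [hstep, map_sub]; ring
  rw [e]
  refine Ideal.add_mem _ ?_ ?_
  · have h := (Ideal.span {(2 : A) ^ (n + 1)}).neg_mem (hL (n + 1))
    rw [neg_sub] at h
    have hle : Ideal.span {(2 : A) ^ (n + 1)} ≤ Ideal.span {(2 : A) ^ n} := by
      rw [Ideal.span_singleton_le_span_singleton]; exact pow_dvd_pow _ (Nat.le_succ n)
    exact hle h
  · exact Ideal.mul_mem_left _ _ (map_mem_span_two_pow α (hL n))

omit [IsAdicComplete (Ideal.span {(2 : A)}) A] in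
/-- **Uniqueness of the fixed point `c = 2κ·α(c) + d`** in a `2`-adically separated ring. [folklore] -/
theorem eq_two_mul_mul_map_add_unique [IsHausdorff (Ideal.span {(2 : A)}) A] {c c' : A} (hc : c = 2 * κ * α c + d)
    (hc' : c' = 2 * κ * α c' + d) : c = c' := by
  have hrel : c - c' = 2 * κ * α (c - c') := by rw [map_sub]; linear_combination hc - hc'
  have hmem : ∀ n : ℕ, c - c' ∈ Ideal.span {(2 : A) ^ n} := by
    intro n
    induction n with
    | zero => rw [pow_zero, Ideal.span_singleton_one]; exact Submodule.mem_top
    | succ n ih =>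
      obtain ⟨g, hg⟩ := Ideal.mem_span_singleton'.mp (map_mem_span_two_pow α ih)
      rw [hrel, ← hg, pow_succ]
      exact Ideal.mem_span_singleton'.mpr ⟨κ * g, by ring⟩
  rw [← sub_eq_zero]
  refine IsHausdorff.haus' (I := Ideal.span {(2 : A)}) _ fun n => ?_
  rw [Ideal.span_singleton_pow, smodEq_smul_top_iff_sub_mem, sub_zero]
  exact hmem n

/-- **`∃! c, c = 2m·α(c) + d`**. [folklore] -/
theorem existsUnique_eq_two_mul_mul_map_add : ∃! c : A, c = 2 * κ * α c + d := by
  obtain ⟨c, hc⟩ := exists_eq_two_mul_mul_map_add α κ d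
  exact ⟨c, hc, fun c' hc' => eq_two_mul_mul_map_add_unique α κ d hc' hc⟩

/-- **The constants relation for the Frobenius model with `u = 2μ`**: for every unit-or-not `μ` and every `ρ` there is `c` with
`4μ²·α(c) − 2c = 2ρ`, i.e. `−r + (2μ)²·α(c) − 2c − e = 0` with `2ρ = r + e` (hypothesis `hκ` of `velu_two_X_sq_mul_sq_subst_eq_domain` with
`vc.u = 2μ`, `c'' = α(c)`). [cite: BlakestadGrant2023, Thm. 2] -/
theorem exists_four_mul_sq_mul_map_sub_two_mul_eq (μ ρ : A) : ∃ c : A, 4 * μ ^ 2 * α c - 2 * c = 2 * ρ := by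
  obtain ⟨c, hc⟩ := exists_eq_two_mul_mul_map_add α (μ ^ 2) (-ρ)
  exact ⟨c, by linear_combination (-2 : A) * hc⟩

end FixedPointMul

end Summit.BirchSwinnertonDyer.BirchSwinnertonDyer.Theorems.AlignedTransportAtTwoSigmaSqTwo
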